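import Summits.AtomisticToContinuum.Crystallization.Theorems.FrustratedLawDichotomyCoherentFloor
import Summits.AtomisticToContinuum.Crystallization.Theorems.FrustratedLawDichotomyForceRemainderSplit

/-!
# FrustratedLawDichotomy · crux `AperiodicFrustratedLawGap` (stmt-AtomisticToContinuum-27623) — T2-S: THE COHERENT-WINDOW FLOOR WITH THE SPLIT FORCE SLOT
# (hdef side, class A; the `fR` slot of PART A `…CoherentFloorAlgebra.windowSum_ge` filled by T1b-F `…ForceRemainderSplit` instead of NODE-10's isotropic
# `forceRem`; decomp-a2c hand-1 g52, interface per lens-5 g112 NOTE 2026-09-04T09:53:01Z, critic r1752 (a))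

§1 (general real inner-product space `V`, PART A vocabulary — nothing re-declared):
* `forceRemSplitR r η α`, `forceRemSplitT r η α` — the two closed-form coefficients of T1b-F (`r` bond length, `η` displacement allowance, free `α > 0`;
  leading terms `½|V_LJ‴(r)|` and `½(α + 1/α)·r|ψ′(r²)|`, the rest `O(η)`);
* ★ `norm_ljBondForce_taylor_split_le` — THE SPLIT FORCE SLOT: `‖ljBondForce (v+w) − ljBondForce v − ljBondForceLin v w‖ ≤`
  `forceRemSplitR ‖v‖ η α · ⟪v,w⟫²/‖v‖² + forceRemSplitT ‖v‖ η α · ‖w‖²` for `‖w‖ ≤ η < ‖v‖` (= `…ForceRemainderSplit.norm_force_remainder_split_le`, by `rfl`);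
* `fRsplit τ α d x x'` — the slot function of a displacement field `d` on the bond `(x, x')` (`η := dispB τ x + dispB τ x'`), `fRsplit_symm`
  (symmetric under `x ↔ x'`), `split_slot_of_template` (discharges `windowSum_ge`'s `hfR` on a `2τ`-separated template), ★★ `windowSum_ge_split`
  (PART A's floor with the split slot).
§2 (`E3`, `7/10` hard core): ★★★ `certFloorSplit_le_two_mul_rootEnergy` and `…_of_nash` — PART B's `certFloor_le_two_mul_rootEnergy(_of_nash)` with the A₂ column
`½·ΣΣ‖Y_x − Y_{x'}‖·forceRem |x − x'| (dispB x + dispB x')` replaced by the QUADRATIC FORM `½·ΣΣ‖Y_x − Y_{x'}‖·fRsplit τ α d_S x x'` in the ACTUAL displacement field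
`d_S z = atomOf S τ z − z` of the coherent configuration (`|d_S z| ≤ τ`): the radial stretch `⟪x − x', d_S x − d_S x'⟫/‖x − x'‖` and `‖d_S x − d_S x'‖` appear explicitly,
which is the object a linear-response / bootstrap lemma (T1c, pre-registration N7-BOOT) bounds; with the box bound `‖d_S x − d_S x'‖ ≤ 2τ` alone it reproduces the
crude booking.  UNITS: FULL (`2·rootEnergy`), as PART B.

DEFS `forceRemSplitR forceRemSplitT fRsplit` (plain `def`s; no instance / notation); imports TREE (226) `…CoherentFloor` (→ (225) PART A, (219), …) and
`…ForceRemainderSplit` (p859176); 0 sorry.  All `[folklore]`; nothing here closes an item.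
-/

noncomputable section

namespace Summit.AtomisticToContinuum.Crystallization.Theorems.FrustratedLawDichotomyCoherentFloorSplit

open MeasureTheory Metric Set Filter RealInnerProductSpace
open scoped BigOperators Topology ENNReal
open Literature.MathematicalPhysics.StatisticalMechanics (lennardJones rootEnergy rootEnergy_def)
open Literature.Probability.Process (IsRootedHardCore count_restrict_singleton_ne_zero_iff)
open Summit.AtomisticToContinuum.Crystallization.Theorems.ChargedEnergyGapNegative (E3)
open Summit.AtomisticToContinuum.Crystallization.Theorems.FrustratedLawDichotomyCoherentSets (coherentAt)
open Summit.AtomisticToContinuum.Crystallization.Theorems.FrustratedLawDichotomyCoherentWindow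
open Summit.AtomisticToContinuum.Crystallization.Theorems.FrustratedLawDichotomyTransportPriceTail (integrable_lennardJones_of_isRootedHardCore)
open Summit.AtomisticToContinuum.Crystallization.Theorems.FrustratedLawDichotomyNashForceBalance (hasSum_force_of_nash)
open Summit.AtomisticToContinuum.Crystallization.Theorems.FrustratedLawDichotomyCoherentFloorAlgebra
open Summit.AtomisticToContinuum.Crystallization.Theorems.FrustratedLawDichotomyCoherentFloor
open Summit.AtomisticToContinuum.Crystallization.Theorems.FrustratedLawDichotomyForceRemainderSplit (norm_force_remainder_split_le)

/-! ## §1. The split force slot in PART A vocabulary -/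

section Slot

variable {V : Type*} [NormedAddCommGroup V] [InnerProductSpace ℝ V]

/-- RADIAL coefficient of T1b-F at bond length `r`, displacement allowance `η`, split parameter `α`:
`r|3ψ′(r²) + 2r²ψ″(r²)| + ½|ψ′(r²)|r(4/α − α − 1/α) + M₃(r+η)D(4r² + 2rη) + |½ψ″(r²)|(2r²η + η(4r² + 2rη))`,
`M₃ = max(20((r−η)²)⁻⁷, 84((r−η)²)⁻¹⁰)`, `D = 2rη + η²`, `½ψ″(t) = 10t⁻⁶ − 28t⁻⁹`; leading term `½|V_LJ‴(r)|`. [folklore] -/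
def forceRemSplitR (r η α : ℝ) : ℝ :=
  r * |3 * psiT1 (r ^ 2) + 4 * (10 * (r ^ 2)⁻¹ ^ 6 - 28 * (r ^ 2)⁻¹ ^ 9) * r ^ 2|
    + 1 / 2 * |psiT1 (r ^ 2)| * r * (4 / α - α - 1 / α)
    + max (20 * ((r - η) ^ 2)⁻¹ ^ 7) (84 * ((r - η) ^ 2)⁻¹ ^ 10) * (r + η) * (2 * r * η + η ^ 2) * (4 * r ^ 2 + 2 * r * η)
    + |10 * (r ^ 2)⁻¹ ^ 6 - 28 * (r ^ 2)⁻¹ ^ 9| * (2 * r ^ 2 * η + η * (4 * r ^ 2 + 2 * r * η))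

/-- TRANSVERSE (isotropic) coefficient of T1b-F: `½|ψ′(r²)|r(α + 1/α) + M₃(r+η)D² + |ψ′(r²)|η + |½ψ″(r²)|(r+η)D`; leading term
`½(α + 1/α)·r|ψ′(r²)|` (`α = √3`: `(2/√3)·r|ψ′(r²)| = (1/√3)|V″/r − V′/r²|`). [folklore] -/
def forceRemSplitT (r η α : ℝ) : ℝ :=
  1 / 2 * |psiT1 (r ^ 2)| * r * (α + 1 / α)
    + max (20 * ((r - η) ^ 2)⁻¹ ^ 7) (84 * ((r - η) ^ 2)⁻¹ ^ 10) * (r + η) * (2 * r * η + η ^ 2) ^ 2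
    + |psiT1 (r ^ 2)| * η
    + |10 * (r ^ 2)⁻¹ ^ 6 - 28 * (r ^ 2)⁻¹ ^ 9| * (r + η) * (2 * r * η + η ^ 2)

/-- ★ THE SPLIT FORCE SLOT (T1b-F in PART A vocabulary): for `‖w‖ ≤ η < ‖v‖` and `0 < α`,
`‖g(v + w) − g(v) − L_v w‖ ≤ forceRemSplitR ‖v‖ η α · ⟪v,w⟫²/‖v‖² + forceRemSplitT ‖v‖ η α · ‖w‖²`. [folklore] -/
theorem norm_ljBondForce_taylor_split_le (v w : V) {η α : ℝ} (hw : ‖w‖ ≤ η) (hv : η < ‖v‖) (hα : 0 < α) :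
    ‖ljBondForce (v + w) - ljBondForce v - ljBondForceLin v w‖
      ≤ forceRemSplitR ‖v‖ η α * (⟪v, w⟫ ^ 2 / ‖v‖ ^ 2) + forceRemSplitT ‖v‖ η α * ‖w‖ ^ 2 :=
  norm_force_remainder_split_le v w hw hv hα

/-- The same with the radial stretch written as `(⟪v,w⟫/‖v‖)²`. [folklore] -/
theorem norm_ljBondForce_taylor_split_le' (v w : V) {η α : ℝ} (hw : ‖w‖ ≤ η) (hv : η < ‖v‖) (hα : 0 < α) :
    ‖ljBondForce (v + w) - ljBondForce v - ljBondForceLin v w‖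
      ≤ forceRemSplitR ‖v‖ η α * (⟪v, w⟫ / ‖v‖) ^ 2 + forceRemSplitT ‖v‖ η α * ‖w‖ ^ 2 := by
  rw [div_pow]
  exact norm_ljBondForce_taylor_split_le v w hw hv hα

variable [DecidableEq V]

/-- The split slot function of a displacement field `d` on the bond `(x, x')` of the template (root pinned: allowance `dispB τ x + dispB τ x'`). -/
def fRsplit (τ α : ℝ) (d : V → V) (x x' : V) : ℝ :=
  forceRemSplitR ‖x - x'‖ (dispB τ x + dispB τ x') α * (⟪x - x', d x - d x'⟫ ^ 2 / ‖x - x'‖ ^ 2)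
    + forceRemSplitT ‖x - x'‖ (dispB τ x + dispB τ x') α * ‖d x - d x'‖ ^ 2

/-- The split slot is symmetric under swapping the bond ends (`v ↦ −v`, `w ↦ −w`). [folklore] -/
theorem fRsplit_symm (τ α : ℝ) (d : V → V) (x x' : V) : fRsplit τ α d x x' = fRsplit τ α d x' x := by
  unfold fRsplit
  rw [norm_sub_rev x x', add_comm (dispB τ x) (dispB τ x'), ← neg_sub x' x, ← neg_sub (d x') (d x), inner_neg_neg, norm_neg]

/-- Discharge of `windowSum_ge`'s force slot with `fRsplit` on a `2τ`-separated template `a ∋ 0` and a displacement field pinned at the root and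
bounded by `τ`. [folklore] -/
theorem split_slot_of_template {a I : Finset V} {τ α : ℝ} (d : V → V) (hα : 0 < α) (hτ0 : 0 ≤ τ) (hIa : I ⊆ a)
    (ha : ∀ x ∈ a, ∀ x' ∈ a, x ≠ x' → 2 * τ < dist x x') (hd0 : d 0 = 0) (hdτ : ∀ z ∈ a, ‖d z‖ ≤ τ) :
    ∀ x ∈ I, ∀ x' ∈ a.erase x,
      ‖ljBondForce ((x + d x) - (x' + d x')) - ljBondForce (x - x') - ljBondForceLin (x - x') (d x - d x')‖ ≤ fRsplit τ α d x x' := by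
  intro x hx x' hx'
  obtain ⟨hx'x, hx'a⟩ := Finset.mem_erase.mp hx'
  have hxa := hIa hx
  have hdisp : ∀ z ∈ a, ‖d z‖ ≤ dispB τ z := fun z hz => by
    unfold dispB
    split_ifs with h
    · rw [h, hd0, norm_zero]
    · exact hdτ z hz
  have hdispτ : ∀ z : V, dispB τ z ≤ τ := fun z => by unfold dispB; split_ifs <;> linarith
  have e : (x + d x) - (x' + d x') = (x - x') + (d x - d x') := by abel
  rw [e]
  unfold fRsplit
  refine norm_ljBondForce_taylor_split_le (x - x') (d x - d x')
    ((norm_sub_le _ _).trans (add_le_add (hdisp x hxa) (hdisp x' hx'a))) ?_ hα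
  have h3 := ha x hxa x' hx'a (Ne.symm hx'x)
  rw [dist_eq_norm] at h3
  linarith [hdispτ x, hdispτ x']

/-- ★★ PART A's COHERENT-WINDOW FLOOR WITH THE SPLIT FORCE SLOT: `windowSum_ge` with `fR := fRsplit τ α d` on a `2τ`-separated template
(`eR`, `C` still free).  The remainder column `½·Σ_{x∈a}Σ_{x'∈a∖x}‖Y_x − Y_{x'}‖·fRsplit τ α d x x'` is a QUADRATIC FORM in the displacement field
`d` separating the radial stretches from the full displacements. [folklore] -/
theorem windowSum_ge_split (a I : Finset V) (y d : V → V) (τ α : ℝ) (eR : V → ℝ) (C : V → ℝ)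
    (hα : 0 < α) (hτ0 : 0 ≤ τ) (hIa : I ⊆ a) (ha : ∀ x ∈ a, ∀ x' ∈ a, x ≠ x' → 2 * τ < dist x x')
    (hd0 : d 0 = 0) (hd : ∀ z ∈ a, ‖d z‖ ≤ τ)
    (heR : ∀ x ∈ a.erase 0, phiT (‖x‖ ^ 2) + psiT (‖x‖ ^ 2) * ⟪x, d x⟫ - eR x ≤ phiT (‖x + d x‖ ^ 2))
    (hC : ∀ x ∈ I, ‖∑ x' ∈ a.erase x, ljBondForce ((x + d x) - (x' + d x'))‖ ≤ C x) :
    ∑ x ∈ a.erase 0, (phiT (‖x‖ ^ 2) - eR x) - τ * ∑ z ∈ a.erase 0, ‖psiT (‖z‖ ^ 2) • z - certCoeff a I y z‖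
        - ∑ x ∈ I, ⟪y x, ∑ x' ∈ a.erase x, ljBondForce (x - x')⟫ - ∑ x ∈ I, ‖y x‖ * C x
        - 1 / 2 * ∑ x ∈ a, ∑ x' ∈ a.erase x, ‖mulExt I y x - mulExt I y x'‖ * fRsplit τ α d x x'
      ≤ ∑ x ∈ a.erase 0, phiT (‖x + d x‖ ^ 2) :=
  windowSum_ge a I y d τ eR (fRsplit τ α d) C hIa hd0 hd heR (split_slot_of_template d hα hτ0 hIa ha hd0 hd) (fRsplit_symm τ α d) hC

end Slot

/-! ## §2. T2-S: the certificate floor with the split A₂ column (`E3`, `7/10` hard core) -/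

/-- ★★★ **T2-S — PART B's coherent-window floor with the SPLIT force slot.**  Same hypotheses as `certFloor_le_two_mul_rootEnergy` plus `0 < α`;
in the conclusion the A₂ column is the quadratic form `½·Σ_{x∈a}Σ_{x'∈a∖x}‖Y_x − Y_{x'}‖·fRsplit τ α d_S x x'` in the ACTUAL displacement field
`d_S z = atomOf S τ z − z` (`‖d_S z‖ ≤ τ`, `d_S 0 = 0`). [folklore] -/
theorem certFloorSplit_le_two_mul_rootEnergy {S : Set E3} {τ α Rc : ℝ} {a I : Finset E3} (y : E3 → E3) (hα : 0 < α)
    (hS : ∀ p ∈ S, ∀ p' ∈ S, p ≠ p' → (7 : ℝ) / 10 ≤ dist p p') (h0S : (0 : E3) ∈ S)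
    (hτ0 : 0 ≤ τ) (hτ : 2 * τ < 7 / 10) (hRc : 1 ≤ Rc)
    (hcoh : (Measure.count.restrict S : Measure E3) ∈ coherentAt a τ Rc)
    (h0a : (0 : E3) ∈ a) (hIa : I ⊆ a) (ha : ∀ x ∈ a, ∀ x' ∈ a, x ≠ x' → 2 * τ < dist x x')
    (hin : ∀ x ∈ a, ‖x‖ + τ ≤ Rc) (hI : ∀ x ∈ I, 7 / 20 ≤ Rc - (‖x‖ + τ))
    (hbal : ∀ x ∈ I, HasSum (fun q : {q : E3 // (Measure.count.restrict S : Measure E3) {q} ≠ 0 ∧ q ≠ atomOf S τ x} =>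
      ((dist (atomOf S τ x) (q : E3))⁻¹ ^ 8 - (dist (atomOf S τ x) (q : E3))⁻¹ ^ 14) • (atomOf S τ x - (q : E3))) 0) :
    ∑ x ∈ a.erase 0, (phiT (‖x‖ ^ 2) - (τ ^ 2 * secondNeg ‖x‖ + energyRem ‖x‖ τ))
        - τ * ∑ z ∈ a.erase 0, ‖psiT (‖z‖ ^ 2) • z - certCoeff a I y z‖
        - ∑ x ∈ I, ⟪y x, ∑ x' ∈ a.erase x, ljBondForce (x - x')⟫
        - ∑ x ∈ I, ‖y x‖ * farCol (Rc - (‖x‖ + τ))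
        - 1 / 2 * ∑ x ∈ a, ∑ x' ∈ a.erase x, ‖mulExt I y x - mulExt I y x'‖ * fRsplit τ α (fun z => atomOf S τ z - z) x x'
        - tailCol Rc
      ≤ 2 * rootEnergy lennardJones (Measure.count.restrict S : Measure E3) := by
  classical
  have h7 : (0 : ℝ) < 7 / 10 := by norm_num
  have hne : ∀ z ∈ a, (closedBall z τ ∩ S).Nonempty := fun z hz => nonempty_of_mem_coherentAt hcoh hz
  -- the displacement field of the coherent window
  set d : E3 → E3 := fun z => atomOf S τ z - z with hd
  have hq : ∀ z, z + d z = atomOf S τ z := fun z => by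
    show z + (atomOf S τ z - z) = atomOf S τ z
    abel
  have hd0 : d 0 = 0 := by
    have h := atomOf_zero hS hτ h0S hτ0
    show atomOf S τ 0 - 0 = 0
    rw [h, sub_zero]
  have hdτ : ∀ z ∈ a, ‖d z‖ ≤ τ := fun z hz => norm_atomOf_sub_le (hne z hz)
  -- (i) energy slots from NODE-12
  have heR : ∀ x ∈ a.erase 0,
      phiT (‖x‖ ^ 2) + psiT (‖x‖ ^ 2) * ⟪x, d x⟫ - (τ ^ 2 * secondNeg ‖x‖ + energyRem ‖x‖ τ) ≤ phiT (‖x + d x‖ ^ 2) := by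
    intro x hx
    obtain ⟨hx0, hxa⟩ := Finset.mem_erase.mp hx
    have hxτ : τ < ‖x‖ := by
      have h := ha x hxa 0 h0a hx0
      rw [dist_zero_right] at h
      linarith
    exact phiT_taylor_ge x (d x) (hdτ x hxa) hxτ
  -- (iv, far part) the force balance split
  have hC : ∀ x ∈ I, ‖∑ x' ∈ a.erase x, ljBondForce ((x + d x) - (x' + d x'))‖ ≤ farCol (Rc - (‖x‖ + τ)) := by
    intro x hx
    simp_rw [hq]
    exact norm_sum_template_force_le hS hτ hcoh ha hin (hIa hx) (hI x hx) (hbal x hx)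
  have hcore := windowSum_ge_split a I y d τ α (fun x => τ ^ 2 * secondNeg ‖x‖ + energyRem ‖x‖ τ)
    (fun x => farCol (Rc - (‖x‖ + τ))) hα hτ0 hIa ha hd0 hdτ heR hC
  beta_reduce at hcore
  -- the energy side: window = template sum (NODE-13), tail ≥ −T♯(Rc)
  have hint := integrable_lennardJones_of_isRootedHardCore h7 ⟨S, h0S, hS, rfl⟩
  have hwin : ∫ z in closedBall (0 : E3) Rc, lennardJones ‖z‖ ∂(Measure.count.restrict S : Measure E3) =
      ∑ x ∈ a.erase 0, phiT (‖x + d x‖ ^ 2) := by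
    rw [setIntegral_closedBall_eq_sum_atomOf hS hτ hcoh hin ha (fun z => lennardJones ‖z‖)]
    beta_reduce
    rw [← Finset.sum_erase_add a _ h0a, atomOf_zero hS hτ h0S hτ0, norm_zero]
    have hV0 : lennardJones 0 = 0 := by unfold lennardJones; simp
    rw [hV0, add_zero]
    exact Finset.sum_congr rfl fun x _ => by rw [lennardJones_eq_phiT, hq]
  have htail := (abs_le.mp (abs_setIntegral_compl_lennardJones_le hS hRc)).1
  have hE : 2 * rootEnergy lennardJones (Measure.count.restrict S : Measure E3) =
      (∫ z in closedBall (0 : E3) Rc, lennardJones ‖z‖ ∂(Measure.count.restrict S : Measure E3)) +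
        ∫ z in (closedBall (0 : E3) Rc)ᶜ, lennardJones ‖z‖ ∂(Measure.count.restrict S : Measure E3) := by
    rw [rootEnergy_def, integral_add_compl measurableSet_closedBall hint]
    ring
  rw [hE, hwin]
  linarith

/-- ★★★ **T2-S under the crux's own clauses** (rooted `7/10` hard core `count⌊S`, NASH clause (e) verbatim, coherence, any multipliers `y`,
any `α > 0`): the split-column floor is at most `2·rootEnergy V_LJ (count⌊S)`. [folklore] -/
theorem certFloorSplit_le_two_mul_rootEnergy_of_nash {S : Set E3} {τ α Rc : ℝ} {a I : Finset E3} (y : E3 → E3) (hα : 0 < α)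
    (hS : ∀ p ∈ S, ∀ p' ∈ S, p ≠ p' → (7 : ℝ) / 10 ≤ dist p p') (h0S : (0 : E3) ∈ S)
    (hNash : ∀ p : E3, (Measure.count.restrict S : Measure E3) {p} ≠ 0 → ∀ w : E3,
      (∀ q : E3, (Measure.count.restrict S : Measure E3) {q} ≠ 0 → q ≠ p → w ≠ q) →
      ∑' q : {q : E3 // (Measure.count.restrict S : Measure E3) {q} ≠ 0 ∧ q ≠ p}, lennardJones (dist p (q : E3)) ≤
        ∑' q : {q : E3 // (Measure.count.restrict S : Measure E3) {q} ≠ 0 ∧ q ≠ p}, lennardJones (dist w (q : E3)))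
    (hτ0 : 0 ≤ τ) (hτ : 2 * τ < 7 / 10) (hRc : 1 ≤ Rc) (hcoh : (Measure.count.restrict S : Measure E3) ∈ coherentAt a τ Rc)
    (h0a : (0 : E3) ∈ a) (hIa : I ⊆ a) (ha : ∀ x ∈ a, ∀ x' ∈ a, x ≠ x' → 2 * τ < dist x x')
    (hin : ∀ x ∈ a, ‖x‖ + τ ≤ Rc) (hI : ∀ x ∈ I, 7 / 20 ≤ Rc - (‖x‖ + τ)) :
    ∑ x ∈ a.erase 0, (phiT (‖x‖ ^ 2) - (τ ^ 2 * secondNeg ‖x‖ + energyRem ‖x‖ τ))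
        - τ * ∑ z ∈ a.erase 0, ‖psiT (‖z‖ ^ 2) • z - certCoeff a I y z‖
        - ∑ x ∈ I, ⟪y x, ∑ x' ∈ a.erase x, ljBondForce (x - x')⟫
        - ∑ x ∈ I, ‖y x‖ * farCol (Rc - (‖x‖ + τ))
        - 1 / 2 * ∑ x ∈ a, ∑ x' ∈ a.erase x, ‖mulExt I y x - mulExt I y x'‖ * fRsplit τ α (fun z => atomOf S τ z - z) x x'
        - tailCol Rc
      ≤ 2 * rootEnergy lennardJones (Measure.count.restrict S : Measure E3) := by
  have hne : ∀ z ∈ a, (closedBall z τ ∩ S).Nonempty := fun z hz => nonempty_of_mem_coherentAt hcoh hz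
  refine certFloorSplit_le_two_mul_rootEnergy y hα hS h0S hτ0 hτ hRc hcoh h0a hIa ha hin hI fun x hx => ?_
  have hp : (Measure.count.restrict S : Measure E3) {atomOf S τ x} ≠ 0 :=
    (count_restrict_singleton_ne_zero_iff S _).mpr (atomOf_mem (hne x (hIa hx))).2
  exact hasSum_force_of_nash (by norm_num : (0 : ℝ) < 7 / 10) ⟨S, h0S, hS, rfl⟩ hp (hNash _ hp)

/-- The crude box reading of the split column: with `‖d x − d x'‖ ≤ 2τ` only (`⟪x − x', ·⟫² ≤ ‖x − x'‖²·‖·‖²`), one split slot is at most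
`(forceRemSplitR + forceRemSplitT)·‖d x − d x'‖²` whenever the radial coefficient is nonnegative — the SPLIT pays only together with
information on the radial stretches (linear response). [folklore] -/
theorem fRsplit_le_of_nonneg {V : Type*} [NormedAddCommGroup V] [InnerProductSpace ℝ V] [DecidableEq V]
    (τ α : ℝ) (d : V → V) (x x' : V) (hR : 0 ≤ forceRemSplitR ‖x - x'‖ (dispB τ x + dispB τ x') α) :
    fRsplit τ α d x x' ≤ (forceRemSplitR ‖x - x'‖ (dispB τ x + dispB τ x') α + forceRemSplitT ‖x - x'‖ (dispB τ x + dispB τ x') α)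
      * ‖d x - d x'‖ ^ 2 := by
  unfold fRsplit
  have hcs : ⟪x - x', d x - d x'⟫ ^ 2 / ‖x - x'‖ ^ 2 ≤ ‖d x - d x'‖ ^ 2 := by
    by_cases hx : ‖x - x'‖ = 0
    · rw [hx]; simp
    · rw [div_le_iff₀ (by positivity), ← mul_pow]
      have h := abs_real_inner_le_norm (x - x') (d x - d x')
      rw [← sq_abs]
      exact pow_le_pow_left₀ (abs_nonneg _) (by rw [mul_comm]; exact h) 2
  nlinarith [mul_le_mul_of_nonneg_left hcs hR]

end Summit.AtomisticToContinuum.Crystallization.Theorems.FrustratedLawDichotomyCoherentFloorSplit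

end
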